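import Literature.Probability.Percolation.TwoEdgeDisjointPaths
import Literature.Combinatorics.SimpleGraph.MengerTwo
import Literature.Combinatorics.SimpleGraph.SeparatingBridges
import HarnessLib

/-!
# Two paths to a common target sharing only separating bridges (edge-Menger with doubled bridges)

Topic `Literature/Probability/Percolation` (graph-theoretic toolbox next to
`TwoEdgeDisjointPaths.lean`; pure `SimpleGraph` statements, no finiteness, no measure).

**The statement** (a corollary of the edge form of Menger's theorem for `k = 2`: Menger 1927;
Diestel, *Graph Theory*, Thm. 3.3.1 and Cor. 3.3.5 (ii), applied to the graph in which every bridge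
is DOUBLED — equivalently, of max-flow min-cut with capacity `2` on bridges and `1` elsewhere).
Let `G` be a simple graph and `a, b, c` vertices with `a` and `b` both joined to `c`. Then there are
an `a`–`c` path `I` and a `b`–`c` path `J` such that every edge lying on BOTH is a bridge of `G`
(Mathlib's `SimpleGraph.IsBridge`), `exists_paths_inter_edges_isBridge`; such an edge then
separates `c` from `a` and from `b` (`SepEdge` of `SeparatingBridges.lean`:
`exists_paths_inter_edges_sepEdge`), and conversely every edge separating `c` from `a` or from `b`
lies on every `a`–`c` resp. `b`–`c` walk (`SepEdge.mem_edges`), so that the paths can be chosen with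
`I.edges ∩ J.edges = {e | e separates c from a and from b}` exactly
(`exists_paths_inter_edges_iff_sepEdge`). The case `a = b` is included (two `a`–`c` paths sharing
exactly the `a`–`c` separating edges).

**Motivation** (percolation). For Bernoulli percolation and the open graph of a configuration `ω`
with `a ↔ b ↔ c`, the two paths are the witnesses `w₁ = E(I)`, `w₂ = E(J)` with
`w₁ ∩ w₂ = Br(c | ab)(ω)` (the open bridges separating `c` from `{a, b}`) used to compare
`{ω ∈ abc, ω′ open on Br(c | ab)(ω)}` with Gladkov's event `A ⋈ B` for `A = {a ↔ c}`, `B = {b ↔ c}`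
(`DecisionTreeBowtie.lean`, Gladkov 2024 Thm. 8.2) — the "Harris loses at most the bridge factor"
bound `E[1{a↔b↔c} ∏_{e ∈ Br(c|ab)} p_e] ≤ P(a ↔ c) P(b ↔ c)` of the crux notes (stmt-4575, MEMO-14
§2c, step (2): "bridge-tree of the open cluster … edge-Menger"). This file supplies exactly that
combinatorial step; the percolation reading is `exists_open_paths_inter_edges_sepEdge`.

**Proof.** Let `G⁺` be the simple graph on `V ⊕ (V × V)` in which `inl u ~ inl v` iff `G.Adj u v`,
and a "midpoint" `inr (x, y)` is adjacent to `inl x` and `inl y` iff `xy` is an edge of `G` that is a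
bridge (so every bridge acquires a parallel route of length two; other midpoints are isolated)
(`BridgeSharing.dbl`). In `G⁺` the vertices `inl a`, `inl c` are `2`-edge-connected
(`BridgeSharing.isEdgeReachable_two_inl`): deleting a non-bridge edge of `G` keeps `a, c` connected in
`G`, deleting the direct copy of a bridge leaves the route through its midpoint, deleting a midpoint
edge leaves the direct copies. Menger (`exists_edgeDisjoint_paths_of_isEdgeReachable_two`,
`TwoEdgeDisjointPaths.lean`) gives two edge-disjoint `inl a`–`inl c` paths `P, Q`; an `a`–`b` walk
lifted to `G⁺` is spliced in at its LAST vertex on `P ∪ Q` (`BridgeSharing.exists_disjoint_of_walk`,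
the theta configuration), giving edge-disjoint walks `I⁺ : inl a → inl c`, `J⁺ : inl b → inl c` of
`G⁺`. Projecting back to `G` (a midpoint step `inl x → inr (x,y) → inl y` becomes the edge `xy`,
`BridgeSharing.proj`), a common edge of the projections that is not a bridge would come from a
common direct edge of `I⁺, J⁺` (`Sym2.map inl` is injective) — impossible; finally `Walk.bypass`
shortens the walks to paths without adding edges.

## Contents

* `BridgeSharing.dbl`, `BridgeSharing.inlHom`, `BridgeSharing.liftM`, `BridgeSharing.proj` — the
  auxiliary graph, the two lifts of walks and the projection, with their edge lemmas;
* `BridgeSharing.reachable_deleteEdges_of_not_isBridge` — deleting a non-bridge preserves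
  reachability of every pair;
* `BridgeSharing.isEdgeReachable_two_inl`, `BridgeSharing.exists_disjoint_of_walk` (splice);
* **`exists_paths_inter_edges_isBridge`**, `IsPath.sepEdge_of_isBridge_of_mem_edges`,
  **`exists_paths_inter_edges_sepEdge`**, `exists_paths_inter_edges_iff_sepEdge`,
  `exists_open_paths_inter_edges_sepEdge`.

## References

* K. Menger, Zur allgemeinen Kurventheorie, *Fund. Math.* 10 (1927) 96–115 [Menger1927].
* R. Diestel, *Graph Theory*, 5th ed., GTM 173, Springer (2017), Thm. 3.3.1, Cor. 3.3.5 (ii)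
  (edge version) [Diestel2017].
* L. R. Ford, D. R. Fulkerson, Maximal flow through a network, *Canad. J. Math.* 8 (1956) 399–404
  (max-flow min-cut; the capacity-`2`-on-bridges reading).
* N. Gladkov, *Percolation Inequalities and Decision Trees*, arXiv:2408.08457v2 (2024), Thm. 8.2
  (the consumer `A ⋈ B`) [Gladkov2024].
-/

namespace Literature.Probability.Percolation

open SimpleGraph

variable {V : Type*} {G : SimpleGraph V}

namespace BridgeSharing

/-! ### The auxiliary graph: every bridge gets a parallel route of length two -/

/-- Adjacency of the auxiliary graph `G⁺` on `V ⊕ (V × V)`: old vertices as in `G`; the midpoint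
`inr (x, y)` is joined to `inl x` and `inl y` when `xy` is an edge of `G` which is a bridge.
[cite: Diestel2017, Cor. 3.3.5 (ii) (applied to the graph with doubled bridges)] -/
def dblAdj (G : SimpleGraph V) : V ⊕ (V × V) → V ⊕ (V × V) → Prop
  | .inl u, .inl v => G.Adj u v
  | .inl u, .inr m => G.Adj m.1 m.2 ∧ G.IsBridge s(m.1, m.2) ∧ (u = m.1 ∨ u = m.2)
  | .inr m, .inl u => G.Adj m.1 m.2 ∧ G.IsBridge s(m.1, m.2) ∧ (u = m.1 ∨ u = m.2)
  | .inr _, .inr _ => False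

/-- The auxiliary simple graph `G⁺` ("`G` with every bridge subdivided-doubled").
[cite: Diestel2017, Cor. 3.3.5 (ii) (applied to the graph with doubled bridges)] -/
def dbl (G : SimpleGraph V) : SimpleGraph (V ⊕ (V × V)) where
  Adj := dblAdj G
  symm := ⟨by
    intro x y h
    cases x <;> cases y
    · exact G.adj_symm h
    · exact h
    · exact h
    · exact h⟩
  loopless := ⟨by
    intro x h
    cases x
    · exact G.irrefl h
    · exact h⟩

/-- Unfolding the adjacency of `G⁺` (old–old). [folklore] -/
@[simp] private theorem dbl_adj_inl_inl {u v : V} :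
    (dbl G).Adj (.inl u) (.inl v) ↔ G.Adj u v := Iff.rfl

/-- Unfolding the adjacency of `G⁺` (old–midpoint). [folklore] -/
@[simp] private theorem dbl_adj_inl_inr {u : V} {m : V × V} :
    (dbl G).Adj (.inl u) (.inr m) ↔ G.Adj m.1 m.2 ∧ G.IsBridge s(m.1, m.2) ∧ (u = m.1 ∨ u = m.2) :=
  Iff.rfl

/-- Unfolding the adjacency of `G⁺` (midpoint–old). [folklore] -/
@[simp] private theorem dbl_adj_inr_inl {u : V} {m : V × V} :
    (dbl G).Adj (.inr m) (.inl u) ↔ G.Adj m.1 m.2 ∧ G.IsBridge s(m.1, m.2) ∧ (u = m.1 ∨ u = m.2) :=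
  Iff.rfl

/-- Midpoints are pairwise non-adjacent in `G⁺`. [folklore] -/
@[simp] private theorem dbl_adj_inr_inr {m m' : V × V} : ¬ (dbl G).Adj (.inr m) (.inr m') :=
  fun h => h

/-- The embedding `V ↪ V ⊕ (V × V)` as a graph homomorphism `G →g G⁺`. [cite: Diestel2017, Cor. 3.3.5 (ii) (applied to the graph with doubled bridges)] -/
def inlHom (G : SimpleGraph V) : G →g dbl G where
  toFun := Sum.inl
  map_rel' := fun h => h

/-- `inlHom` is `Sum.inl` on vertices. [folklore] -/
@[simp] private theorem inlHom_apply (v : V) : inlHom G v = Sum.inl v := rfl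

/-- An edge of the form `Sym2.map inl e'` is never a midpoint edge. [folklore] -/
private theorem map_inl_ne_inl_inr (e' : Sym2 V) (u : V) (m : V × V) :
    Sym2.map (Sum.inl : V → V ⊕ (V × V)) e' ≠ s(.inl u, .inr m) := by
  induction e' using Sym2.ind with
  | _ x y =>
    intro h
    rw [Sym2.map_mk, Sym2.eq_iff] at h
    rcases h with ⟨-, h⟩ | ⟨h, -⟩
    · exact Sum.inl_ne_inr h
    · exact Sum.inl_ne_inr h

/-- `Sym2.map inl s(x, y) = s(inl u, inl v)` forces `s(x, y) = s(u, v)`. [folklore] -/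
private theorem eq_of_map_inl_eq {e' : Sym2 V} {u v : V}
    (h : Sym2.map (Sum.inl : V → V ⊕ (V × V)) e' = s(.inl u, .inl v)) : e' = s(u, v) := by
  have h' : Sym2.map (Sum.inl : V → V ⊕ (V × V)) e' = Sym2.map Sum.inl s(u, v) := by
    rw [h, Sym2.map_mk]
  exact Sym2.map.injective Sum.inl_injective h'

/-- Edges of a lifted walk `p.map inlHom` are the images `Sym2.map inl` of the edges of `p`.
[folklore] -/
private theorem mem_edges_map_inlHom {u v : V} (p : G.Walk u v) {e : Sym2 (V ⊕ (V × V))}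
    (he : e ∈ (p.map (inlHom G)).edges) : ∃ e' ∈ p.edges, Sym2.map Sum.inl e' = e := by
  rw [Walk.edges_map] at he
  obtain ⟨e', he', rfl⟩ := List.mem_map.1 he
  exact ⟨e', he', rfl⟩

/-! ### The lift routing bridges through their midpoints -/

open Classical in
/-- Lift of a walk of `G` to `G⁺` taking every BRIDGE `xy` along the route `inl x → inr (x,y) → inl y`
and every other edge directly. [cite: Diestel2017, Cor. 3.3.5 (ii) (applied to the graph with doubled bridges)] -/
noncomputable def liftM : ∀ {u v : V}, G.Walk u v → (dbl G).Walk (.inl u) (.inl v)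
  | _, _, .nil => .nil
  | u, _, .cons (v := w) h p =>
    if hb : G.IsBridge s(u, w) then
      .cons (show (dbl G).Adj (.inl u) (.inr (u, w)) from ⟨h, hb, Or.inl rfl⟩)
        (.cons (show (dbl G).Adj (.inr (u, w)) (.inl w) from ⟨h, hb, Or.inr rfl⟩) (liftM p))
    else .cons (show (dbl G).Adj (.inl u) (.inl w) from h) (liftM p)

/-- The edges of `liftM p`: direct copies of NON-bridge edges of `G`, and midpoint edges.
[folklore] -/
private theorem mem_edges_liftM : ∀ {u v : V} (p : G.Walk u v) {e : Sym2 (V ⊕ (V × V))},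
    e ∈ (liftM p).edges →
      (∃ x y : V, G.Adj x y ∧ ¬ G.IsBridge s(x, y) ∧ e = s(.inl x, .inl y)) ∨
        ∃ (x : V) (m : V × V), e = s(.inl x, .inr m)
  | _, _, .nil, e, he => by simp [liftM] at he
  | u, _, .cons (v := w) h p, e, he => by
    classical
    unfold liftM at he
    split_ifs at he with hb
    · rw [Walk.edges_cons, Walk.edges_cons, List.mem_cons, List.mem_cons] at he
      rcases he with rfl | rfl | he
      · exact Or.inr ⟨u, (u, w), rfl⟩
      · exact Or.inr ⟨w, (u, w), Sym2.eq_swap⟩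
      · exact mem_edges_liftM p he
    · rw [Walk.edges_cons, List.mem_cons] at he
      rcases he with rfl | he
      · exact Or.inl ⟨u, w, h, hb, rfl⟩
      · exact mem_edges_liftM p he

/-! ### Deleting a non-bridge preserves reachability -/

/-- If the endpoints of `xy` stay connected after deleting `xy`, then so does every pair of
vertices that was connected in `G`. [cite: Diestel2017, §1.4 (bridges / cut-edges)] -/
theorem reachable_deleteEdges_of_reachable_deleteEdges {x y : V}
    (hxy : (G.deleteEdges {s(x, y)}).Reachable x y) :
    ∀ {a c : V}, G.Walk a c → (G.deleteEdges {s(x, y)}).Reachable a c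
  | _, _, .nil => Reachable.refl _
  | a, c, .cons (v := w) h p => by
    refine Reachable.trans ?_ (reachable_deleteEdges_of_reachable_deleteEdges hxy p)
    by_cases he : s(a, w) = s(x, y)
    · rcases Sym2.eq_iff.1 he with ⟨rfl, rfl⟩ | ⟨rfl, rfl⟩
      · exact hxy
      · exact hxy.symm
    · exact Adj.reachable ((deleteEdges_adj).2 ⟨h, by simpa using he⟩)

/-- Deleting an edge that is NOT a bridge preserves reachability of every pair. [cite: Diestel2017, §1.4 (bridges / cut-edges)] -/
theorem reachable_deleteEdges_of_not_isBridge {x y : V} (hb : ¬ G.IsBridge s(x, y)) {a c : V}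
    (hac : G.Reachable a c) : (G.deleteEdges {s(x, y)}).Reachable a c := by
  obtain ⟨p⟩ := hac
  have hxy : (G.deleteEdges {s(x, y)}).Reachable x y := by
    rw [isBridge_iff] at hb
    exact not_not.1 hb
  exact reachable_deleteEdges_of_reachable_deleteEdges hxy p

/-! ### `inl a` and `inl c` are `2`-edge-connected in `G⁺` -/

/-- In `G⁺` two vertices of `G` joined in `G` are `2`-edge-connected: every single edge of `G⁺` can
be avoided. [cite: Diestel2017, Cor. 3.3.5 (ii) (applied to the graph with doubled bridges)] -/
theorem isEdgeReachable_two_inl {a c : V} (hac : G.Reachable a c) :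
    (dbl G).IsEdgeReachable 2 (.inl a) (.inl c) := by
  classical
  obtain ⟨q⟩ := hac
  rw [SimpleGraph.isEdgeReachable_two]
  intro e
  induction e using Sym2.ind with
  | _ X Y =>
    rw [reachable_deleteEdges_iff_exists_walk]
    -- the direct lift avoids every edge which is not a direct copy of an edge of `G`
    have hD : ∀ e : Sym2 (V ⊕ (V × V)), (∀ e' : Sym2 V, Sym2.map Sum.inl e' ≠ e) →
        ∃ p : (dbl G).Walk (.inl a) (.inl c), e ∉ p.edges := fun e hne =>
      ⟨q.map (inlHom G), fun he => by
        obtain ⟨e', -, he'⟩ := mem_edges_map_inlHom q he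
        exact hne e' he'⟩
    cases X with
    | inr m =>
      obtain ⟨p, hp⟩ := hD s(.inr m, Y) fun e' he' => by
        cases Y with
        | inl v => exact map_inl_ne_inl_inr e' v m (by rw [he', Sym2.eq_swap])
        | inr m' =>
          induction e' using Sym2.ind with
          | _ x y =>
            rw [Sym2.map_mk, Sym2.eq_iff] at he'
            rcases he' with ⟨h, -⟩ | ⟨h, -⟩ <;> exact Sum.inl_ne_inr h
      exact ⟨p, hp⟩
    | inl u =>
      cases Y with
      | inr m => exact hD _ fun e' he' => map_inl_ne_inl_inr e' u m he'
      | inl v =>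
        by_cases hb : G.IsBridge s(u, v)
        · -- the lift through the midpoints avoids the direct copy of a bridge
          refine ⟨liftM q, fun he => ?_⟩
          rcases mem_edges_liftM q he with ⟨x, y, -, hnb, hxy⟩ | ⟨x, m, hxm⟩
          · have h1 : Sym2.map (Sum.inl : V → V ⊕ (V × V)) s(u, v) = s(.inl x, .inl y) := by
              rw [Sym2.map_mk]; exact hxy
            have h2 : s(u, v) = s(x, y) := eq_of_map_inl_eq h1
            exact hnb (h2 ▸ hb)
          · exact map_inl_ne_inl_inr s(u, v) x m (by rw [Sym2.map_mk]; exact hxm)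
        · -- a non-bridge of `G` is avoided inside `G`
          have hr : (G.deleteEdges {s(u, v)}).Reachable a c :=
            reachable_deleteEdges_of_not_isBridge hb ⟨q⟩
          obtain ⟨q', hq'⟩ := reachable_deleteEdges_iff_exists_walk.1 hr
          refine ⟨q'.map (inlHom G), fun he => hq' ?_⟩
          obtain ⟨e', he', hmap⟩ := mem_edges_map_inlHom q' he
          rwa [eq_of_map_inl_eq hmap] at he'

/-! ### The splice (theta configuration) -/

/-- An edge of a walk has both endpoints on the walk. [folklore] -/
private theorem mem_support_of_mem_edges {W : Type*} {H : SimpleGraph W} {u v : W} (p : H.Walk u v)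
    {e : Sym2 W} (he : e ∈ p.edges) {z : W} (hz : z ∈ e) : z ∈ p.support := by
  induction e using Sym2.ind with
  | _ x y =>
    rcases Sym2.mem_iff.1 hz with rfl | rfl
    · exact p.fst_mem_support_of_mem_edges he
    · exact p.snd_mem_support_of_mem_edges he

/-- Core of the splice: if the last vertex `z` of an `z`–`b` walk `S₂` on `P ∪ Q` lies on `P`, then
`Q` and `S₂⁻¹ · P[z →]` are edge-disjoint. [cite: Diestel2017, Thm. 3.3.1 (augmenting step)] -/
private theorem exists_disjoint_of_last {W : Type*} {H : SimpleGraph W} {a b c z : W}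
    (P Q : H.Walk a c) (hPQ : List.Disjoint P.edges Q.edges) (S₂ : H.Walk z b)
    (hlast : ∀ y ∈ S₂.support, (y ∈ P.support ∨ y ∈ Q.support) → y = z) (hzP : z ∈ P.support) :
    ∃ (I : H.Walk a c) (J : H.Walk b c), List.Disjoint I.edges J.edges := by
  classical
  refine ⟨Q, S₂.reverse.append (P.dropUntil z hzP), fun e heQ heJ => ?_⟩
  rw [Walk.edges_append, List.mem_append, Walk.edges_reverse, List.mem_reverse] at heJ
  rcases heJ with heS | heP
  · -- an edge of `S₂` lying on `Q` has both endpoints equal to `z`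
    have hQe := Q.edges_subset_edgeSet heQ
    induction e using Sym2.ind with
    | _ x y =>
      have hx : x = z := hlast x (mem_support_of_mem_edges S₂ heS (Sym2.mem_mk_left x y))
        (Or.inr (mem_support_of_mem_edges Q heQ (Sym2.mem_mk_left x y)))
      have hy : y = z := hlast y (mem_support_of_mem_edges S₂ heS (Sym2.mem_mk_right x y))
        (Or.inr (mem_support_of_mem_edges Q heQ (Sym2.mem_mk_right x y)))
      subst hx; subst hy
      exact H.irrefl (H.mem_edgeSet.1 hQe)
  · exact hPQ (P.edges_dropUntil_subset_edges hzP heP) heQ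

/-- **Splice.** Two edge-disjoint `a`–`c` walks and an `a`–`b` walk yield edge-disjoint walks
`a → c` and `b → c` (split the `a`–`b` walk at its last vertex on the two given walks).
[cite: Diestel2017, Thm. 3.3.1 (augmenting step)] -/
theorem exists_disjoint_of_walk {W : Type*} {H : SimpleGraph W} {a b c : W}
    (P Q : H.Walk a c) (hPQ : List.Disjoint P.edges Q.edges) (S : H.Walk a b) :
    ∃ (I : H.Walk a c) (J : H.Walk b c), List.Disjoint I.edges J.edges := by
  obtain ⟨z, S₁, S₂, -, hz, hlast⟩ :=
    Literature.Combinatorics.SimpleGraph.exists_append_last_mem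
      {y | y ∈ P.support ∨ y ∈ Q.support} S
      ⟨a, S.start_mem_support, Or.inl P.start_mem_support⟩
  rcases hz with hzP | hzQ
  · exact exists_disjoint_of_last P Q hPQ S₂ hlast hzP
  · obtain ⟨I, J, hIJ⟩ := exists_disjoint_of_last Q P hPQ.symm S₂
      (fun y hy hyL => hlast y hy (Or.symm hyL)) hzQ
    exact ⟨I, J, hIJ⟩

/-! ### Projection back to `G` -/

/-- Vertex projection `V ⊕ (V × V) → V`: a midpoint goes to the first entry of its pair.
[folklore] -/
def pv : V ⊕ (V × V) → V
  | .inl v => v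
  | .inr m => m.1

/-- `pv` on old vertices. [folklore] -/
@[simp] private theorem pv_inl (v : V) : pv (.inl v : V ⊕ (V × V)) = v := rfl

/-- `pv` on midpoints. [folklore] -/
@[simp] private theorem pv_inr (m : V × V) : pv (.inr m : V ⊕ (V × V)) = m.1 := rfl

open Classical in
/-- Projection of one step of `G⁺` to a walk of `G` of length `≤ 1`: a direct edge is kept, a step
to or from a midpoint becomes either nothing or the bridge itself. [folklore] -/
noncomputable def stepProj : ∀ (x y : V ⊕ (V × V)), (dbl G).Adj x y → G.Walk (pv x) (pv y)
  | .inl _, .inl _ => fun h => Walk.cons h Walk.nil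
  | .inl u, .inr m => fun h =>
    if hu : u = m.1 then (Walk.nil : G.Walk u u).copy rfl hu
    else Walk.cons (show G.Adj u m.1 by
      rw [(h.2.2.resolve_left hu : u = m.2)]; exact h.1.symm) Walk.nil
  | .inr m, .inl v => fun h =>
    if hv : v = m.1 then (Walk.nil : G.Walk m.1 m.1).copy rfl hv.symm
    else Walk.cons (show G.Adj m.1 v by
      rw [(h.2.2.resolve_left hv : v = m.2)]; exact h.1) Walk.nil
  | .inr _, .inr _ => fun h => (dbl_adj_inr_inr h).elim

/-- Edges of a projected step: the direct edge, or a bridge. [folklore] -/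
private theorem mem_edges_stepProj {x y : V ⊕ (V × V)} (h : (dbl G).Adj x y) {e : Sym2 V}
    (he : e ∈ (stepProj x y h).edges) :
    (∃ u v : V, x = .inl u ∧ y = .inl v ∧ e = s(u, v)) ∨ G.IsBridge e := by
  classical
  cases x with
  | inl u =>
    cases y with
    | inl v =>
      left
      refine ⟨u, v, rfl, rfl, ?_⟩
      simpa [stepProj] using he
    | inr m =>
      right
      dsimp only [stepProj] at he
      split_ifs at he with hu
      · simp at he
      · simp only [Walk.edges_cons, Walk.edges_nil, List.mem_cons, List.not_mem_nil, or_false,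
          pv_inl, pv_inr] at he
        have hu2 : u = m.2 := h.2.2.resolve_left hu
        rw [he, hu2, Sym2.eq_swap]
        exact h.2.1
  | inr m =>
    cases y with
    | inl v =>
      right
      dsimp only [stepProj] at he
      split_ifs at he with hv
      · simp at he
      · simp only [Walk.edges_cons, Walk.edges_nil, List.mem_cons, List.not_mem_nil, or_false,
          pv_inl, pv_inr] at he
        have hv2 : v = m.2 := h.2.2.resolve_left hv
        rw [he, hv2]
        exact h.2.1
    | inr m' => exact (dbl_adj_inr_inr h).elim

/-- Projection of a walk of `G⁺` to a walk of `G` (concatenate the projected steps). [folklore] -/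
noncomputable def proj : ∀ {x y : V ⊕ (V × V)}, (dbl G).Walk x y → G.Walk (pv x) (pv y)
  | _, _, .nil => .nil
  | _, _, .cons h p => (stepProj _ _ h).append (proj p)

/-- Every edge of a projected walk is either the image of a DIRECT edge of the original walk or a
bridge of `G`. [folklore] -/
private theorem mem_edges_proj : ∀ {x y : V ⊕ (V × V)} (p : (dbl G).Walk x y) {e : Sym2 V},
    e ∈ (proj p).edges →
      (∃ u v : V, s(Sum.inl u, Sum.inl v) ∈ p.edges ∧ e = s(u, v)) ∨ G.IsBridge e
  | _, _, .nil, e, he => by simp [proj] at he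
  | x, z, .cons (v := y) h p, e, he => by
    unfold proj at he
    rw [Walk.edges_append, List.mem_append] at he
    rcases he with he | he
    · rcases mem_edges_stepProj h he with ⟨u, v, rfl, rfl, rfl⟩ | hb
      · exact Or.inl ⟨u, v, by simp, rfl⟩
      · exact Or.inr hb
    · rcases mem_edges_proj p he with ⟨u, v, huv, rfl⟩ | hb
      · exact Or.inl ⟨u, v, by rw [Walk.edges_cons]; exact List.mem_cons_of_mem _ huv, rfl⟩
      · exact Or.inr hb

end BridgeSharing

open BridgeSharing

/-! ### The theorem -/

/-- **Two paths to a common target sharing only bridges.** If `a` and `b` are both joined to `c`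
in a simple graph `G`, there are an `a`–`c` path and a `b`–`c` path such that every edge lying on
both is a bridge of `G` (Menger's theorem, edge form, `k = 2`, in the graph with every bridge
doubled; `a = b` allowed). [cite: Diestel2017, Thm. 3.3.1 and Cor. 3.3.5 (ii) (edge version, applied to the graph with doubled bridges)] [cite: Menger1927] -/
theorem exists_paths_inter_edges_isBridge {a b c : V} (hac : G.Reachable a c)
    (hbc : G.Reachable b c) :
    ∃ (I : G.Walk a c) (J : G.Walk b c), I.IsPath ∧ J.IsPath ∧
      ∀ e ∈ I.edges, e ∈ J.edges → G.IsBridge e := by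
  classical
  -- two edge-disjoint `a`–`c` paths of `G⁺`, and the splice with an `a`–`b` walk
  obtain ⟨P, Q, -, -, hPQ⟩ :=
    exists_edgeDisjoint_paths_of_isEdgeReachable_two (isEdgeReachable_two_inl hac)
  obtain ⟨S⟩ := hac.trans hbc.symm
  obtain ⟨I', J', hIJ⟩ := exists_disjoint_of_walk P Q hPQ (S.map (inlHom G))
  -- project and shorten
  refine ⟨(proj I').bypass, (proj J').bypass, Walk.bypass_isPath _, Walk.bypass_isPath _,
    fun e heI heJ => ?_⟩
  have heI' := (proj I').edges_bypass_subset_edges heI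
  have heJ' := (proj J').edges_bypass_subset_edges heJ
  rcases mem_edges_proj I' heI' with ⟨u, v, huv, rfl⟩ | hb
  · rcases mem_edges_proj J' heJ' with ⟨u', v', hu'v', he⟩ | hb
    · have h3 : s((Sum.inl u : V ⊕ (V × V)), Sum.inl v) = s(Sum.inl u', Sum.inl v') := by
        have h3' := congrArg (Sym2.map (Sum.inl : V → V ⊕ (V × V))) he
        rwa [Sym2.map_mk, Sym2.map_mk] at h3'
      rw [← h3] at hu'v'
      exact absurd hu'v' (hIJ huv)
    · exact hb
  · exact hb

/-- **A bridge on a path separates its endpoints**: if a path from `a` to `c` uses a bridge `e`,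
then `e` separates `a` from `c` (`SepEdge`). [cite: Diestel2017, §1.4 and Thm. 3.3.1] -/
theorem IsPath.sepEdge_of_isBridge_of_mem_edges {a c : V} {p : G.Walk a c} (hp : p.IsPath)
    {e : Sym2 V} (he : e ∈ p.edges) (hb : G.IsBridge e) :
    Literature.Combinatorics.SimpleGraph.SepEdge G a c e := by
  refine ⟨p.edges_subset_edgeSet he, fun hr => ?_⟩
  obtain ⟨d, hd, rfl⟩ := List.mem_map.1 he
  have h1 := Literature.Combinatorics.SimpleGraph.reachable_deleteEdges_fst_of_mem_darts hp hd
  have h2 := Literature.Combinatorics.SimpleGraph.reachable_deleteEdges_snd_of_mem_darts hp hd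
  have h3 : (G.deleteEdges {d.edge}).Reachable d.fst d.snd := h1.symm.trans (hr.trans h2.symm)
  have hb' : G.IsBridge s(d.fst, d.snd) := hb
  exact (isBridge_iff.1 hb') h3

/-- **Two paths to a common target sharing only separating edges**: the common edges of the two
paths separate `c` from `a` AND from `b`. [cite: Diestel2017, Thm. 3.3.1 and Cor. 3.3.5 (ii) (edge version, applied to the graph with doubled bridges)] -/
theorem exists_paths_inter_edges_sepEdge {a b c : V} (hac : G.Reachable a c)
    (hbc : G.Reachable b c) :
    ∃ (I : G.Walk a c) (J : G.Walk b c), I.IsPath ∧ J.IsPath ∧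
      ∀ e ∈ I.edges, e ∈ J.edges →
        Literature.Combinatorics.SimpleGraph.SepEdge G c a e ∧
          Literature.Combinatorics.SimpleGraph.SepEdge G c b e := by
  obtain ⟨I, J, hI, hJ, h⟩ := exists_paths_inter_edges_isBridge hac hbc
  refine ⟨I, J, hI, hJ, fun e heI heJ => ?_⟩
  have hb := h e heI heJ
  obtain ⟨h1, h1'⟩ := IsPath.sepEdge_of_isBridge_of_mem_edges hI heI hb
  obtain ⟨h2, h2'⟩ := IsPath.sepEdge_of_isBridge_of_mem_edges hJ heJ hb
  exact ⟨⟨h1, fun hr => h1' hr.symm⟩, ⟨h2, fun hr => h2' hr.symm⟩⟩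

/-- **Exact form**: the two paths can be chosen so that their common edges are EXACTLY the edges
separating `c` from both `a` and `b` (the converse inclusion because a separating edge lies on every
walk, `SepEdge.mem_edges`).
[cite: Diestel2017, Thm. 3.3.1 and Cor. 3.3.5 (ii) (edge version, applied to the graph with doubled bridges)] -/
theorem exists_paths_inter_edges_iff_sepEdge {a b c : V} (hac : G.Reachable a c)
    (hbc : G.Reachable b c) :
    ∃ (I : G.Walk a c) (J : G.Walk b c), I.IsPath ∧ J.IsPath ∧
      ∀ e, (e ∈ I.edges ∧ e ∈ J.edges) ↔
        (Literature.Combinatorics.SimpleGraph.SepEdge G c a e ∧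
          Literature.Combinatorics.SimpleGraph.SepEdge G c b e) := by
  obtain ⟨I, J, hI, hJ, h⟩ := exists_paths_inter_edges_sepEdge hac hbc
  refine ⟨I, J, hI, hJ, fun e => ⟨fun he => h e he.1 he.2, fun he => ⟨?_, ?_⟩⟩⟩
  · have := Literature.Combinatorics.SimpleGraph.SepEdge.mem_edges he.1 I.reverse
    rwa [Walk.edges_reverse, List.mem_reverse] at this
  · have := Literature.Combinatorics.SimpleGraph.SepEdge.mem_edges he.2 J.reverse
    rwa [Walk.edges_reverse, List.mem_reverse] at this

/-! ### Percolation reading -/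

/-- **Percolation reading** (the combinatorial step behind "Harris loses at most the bridge
factor"): if `a ↔ c` and `b ↔ c` in the open graph of a bond configuration `ω`, there are OPEN paths
`I : a → c`, `J : b → c` (all their edges open) whose common edges are exactly the open edges
separating `c` from `a` and from `b` in the open graph — the open `c | ab` bridges.
[cite: Gladkov2024, Thm. 8.2 (the event A ⋈ B, witnesses w₁, w₂)] [cite: Diestel2017, Cor. 3.3.5 (ii)] -/
theorem exists_open_paths_inter_edges_sepEdge {ω : BondConfig V} {a b c : V}
    (hac : (openGraph ω).Reachable a c) (hbc : (openGraph ω).Reachable b c) :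
    ∃ (I : (openGraph ω).Walk a c) (J : (openGraph ω).Walk b c), I.IsPath ∧ J.IsPath ∧
      (∀ e ∈ I.edges, e ∈ ω) ∧ (∀ e ∈ J.edges, e ∈ ω) ∧
      ∀ e, (e ∈ I.edges ∧ e ∈ J.edges) ↔
        (Literature.Combinatorics.SimpleGraph.SepEdge (openGraph ω) c a e ∧
          Literature.Combinatorics.SimpleGraph.SepEdge (openGraph ω) c b e) := by
  obtain ⟨I, J, hI, hJ, h⟩ := exists_paths_inter_edges_iff_sepEdge hac hbc
  exact ⟨I, J, hI, hJ, fun e he => mem_of_mem_walk_edges I he,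
    fun e he => mem_of_mem_walk_edges J he, h⟩

end Literature.Probability.Percolation
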